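import Summits.QuantumAdvantage.QuantumAdvantage.Theorems.CubicForrelationNearExactIsExactFourteenSecondBent

/-!
# Crux `CubicForrelation.NearExactIsExact` (stmt-QuantumAdvantage-14043) — tools for flat sums with a LIST of directions: parametrised flat sums
  as list sums, localisation to a coset by peeling any number of transversal directions, and existence of transversal chains

Certificate seat `b2b-cforr-cert` (gen 45).  HONEST FRAMING: bookkeeping TOOLS (standard axioms, uniform in the number of bits and in the number
of directions) for the uniform-in-`n` version of `fo_bent_false` (gen 9) / `fo18_bent_ne_31_32` / `fo22_bent_ne_63_64` (gen 45), where the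
number of transversal directions to peel grows with `n`.  NOT summit progress.

With `step t L = L ++ L.map (· ⊕ t)` and the point list `P(ts, q) = ts.foldr step [q]` of the parametrised flat `q ⊕ ⟨ts⟩` (multiplicities
included):
* `kbm_sum_flat_list`: the tree's parametrised flat sum `Σ_{ε : Fin k → 𝔽₂} F(q ⊕ Σ εᵢaᵢ)` equals `(P(List.ofFn a, q).map F).sum`
  (induction on `k` with `fr_sum_peel`);
* `kbm_pts_mem`: if all directions lie in a `⊕`-closed `U ∋ 0` then every point `x` of `P(ts, q)` has `q ⊕ x ∈ U`;
* `kbm_peel_all`: if `τ` vanishes off the coset `q ⊕ V` and the directions `ts` admit a TRANSVERSAL CHAIN (for each `i` a closed `Uᵢ ⊇ V` with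
  `tsᵢ ∉ Uᵢ` containing the later directions), then `(P(ts ++ rest, q).map τ).sum = (P(rest, q).map τ).sum` for `rest ⊆ V`;
* `kbm_chain_exists`: a closed `V ∋ 0` with `2^i·#V < 2^n` admits a transversal chain of length `i` (iterated doubling, `fo_double_closed`).

References: MacWilliams–Sloane (1977) Ch. 13 §4 (flats); the bookkeeping is this work's.  Axioms: the standard three.
-/

set_option linter.dupNamespace false -- D-0017: single-problem summit ⇒ `QuantumAdvantage.QuantumAdvantage` by design

noncomputable section

namespace Summit.QuantumAdvantage.QuantumAdvantage.Theorems.CubicForrelation.NearExactIsExact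

open Finset
open Literature.Computability.QuantumComplexity
open Literature.Computability.QuantumComplexity.BuzetChailloux (bxor zeroVec bxor_bxor_cancel_left bxor_zeroVec zeroVec_bxor bxor_comm
  bxor_self)

variable {n : ℕ}

/-! ### Parametrised flat sums as list sums -/

/-- **Flat sum = list sum.**  For `a : Fin k → 𝔽₂ⁿ`, `Σ_{ε} F(q ⊕ Σᵢ εᵢ aᵢ) = (P(List.ofFn a, q).map F).sum` with
`P(ts, q) = ts.foldr (fun t L => L ++ L.map (· ⊕ t)) [q]`. [folklore] -/
theorem kbm_sum_flat_list : ∀ (k : ℕ) (F : (Fin n → Bool) → ℤ) (q : Fin n → Bool) (a : Fin k → Fin n → Bool),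
    ∑ ε : Fin k → Bool, F (fun j => q j ^^ decide (Odd #(univ.filter fun i => ε i && a i j))) =
      (((List.ofFn a).foldr (fun t L => L ++ L.map (fun x => bxor x t)) [q]).map F).sum := by
  intro k
  induction k with
  | zero =>
    intro F q a
    simp only [univ_unique, sum_singleton, tep_flatPt_nil, List.ofFn_zero, List.foldr_nil, List.map_cons, List.map_nil,
      List.sum_cons, List.sum_nil, add_zero]
  | succ k ih =>
    intro F q a
    have ha : a = Matrix.vecCons (a 0) (Fin.tail a) := (Fin.cons_self_tail a).symm
    conv_lhs => rw [ha]
    rw [fr_sum_peel F q (a 0) (Fin.tail a), ih F q (Fin.tail a), ih (fun x => F (bxor x (a 0))) q (Fin.tail a)]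
    rw [List.ofFn_succ, List.foldr_cons, List.map_append, List.sum_append, List.map_map]
    rfl

/-- **Points of `P(ts, q)` differ from `q` by an element of any closed `U ∋ 0` containing the directions.** [folklore] -/
theorem kbm_pts_mem : ∀ (ts : List (Fin n → Bool)) (U : Finset (Fin n → Bool)), zeroVec ∈ U →
    (∀ a ∈ U, ∀ b ∈ U, bxor a b ∈ U) → (∀ t ∈ ts, t ∈ U) → ∀ (q x : Fin n → Bool),
    x ∈ ts.foldr (fun t L => L ++ L.map (fun x => bxor x t)) [q] → bxor q x ∈ U := by
  intro ts
  induction ts with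
  | nil =>
    intro U h0 _ _ q x hx
    rw [List.foldr_nil, List.mem_singleton] at hx
    rw [hx, bxor_self]; exact h0
  | cons t ts ih =>
    intro U h0 hadd hts q x hx
    rw [List.foldr_cons, List.mem_append, List.mem_map] at hx
    have hts' : ∀ t' ∈ ts, t' ∈ U := fun t' ht' => hts t' (List.mem_cons_of_mem _ ht')
    rcases hx with hx | ⟨y, hy, rfl⟩
    · exact ih U h0 hadd hts' q x hx
    · rw [← iw_bxor_assoc]
      exact hadd _ (ih U h0 hadd hts' q y hy) _ (hts t List.mem_cons_self)

/-- **Peeling every transversal direction.**  Let `V ∋ 0` be `⊕`-closed, `τ` vanish off the coset `q ⊕ V`, `rest ⊆ V`, and let the directions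
`ts` admit a transversal chain: for each index `i` a `⊕`-closed `Uᵢ ∋ 0` with `V ⊆ Uᵢ`, `ts[i] ∉ Uᵢ` and `ts[i'] ∈ Uᵢ` for `i' > i`.  Then the
`τ`-sum over `P(ts ++ rest, q)` equals the `τ`-sum over `P(rest, q)` (every peeled half lies off the coset). [this work] -/
theorem kbm_peel_all (V : Finset (Fin n → Bool)) (q : Fin n → Bool) (τ : (Fin n → Bool) → ℤ) (hτ : ∀ x, x ∉ V.image (bxor q) → τ x = 0)
    (rest : List (Fin n → Bool)) (hrest : ∀ r ∈ rest, r ∈ V) :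
    ∀ (ts : List (Fin n → Bool)),
      (∀ i (hi : i < ts.length), ∃ U : Finset (Fin n → Bool), zeroVec ∈ U ∧ (∀ a ∈ U, ∀ b ∈ U, bxor a b ∈ U) ∧ V ⊆ U ∧
        ts[i] ∉ U ∧ ∀ i' (hi' : i' < ts.length), i < i' → ts[i'] ∈ U) →
      (((ts ++ rest).foldr (fun t L => L ++ L.map (fun x => bxor x t)) [q]).map τ).sum =
        ((rest.foldr (fun t L => L ++ L.map (fun x => bxor x t)) [q]).map τ).sum := by
  intro ts
  induction ts with
  | nil => intro _; rfl
  | cons t ts ih =>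
    intro hchain
    -- the chain for the tail
    have hchain' : ∀ i (hi : i < ts.length), ∃ U : Finset (Fin n → Bool), zeroVec ∈ U ∧ (∀ a ∈ U, ∀ b ∈ U, bxor a b ∈ U) ∧ V ⊆ U ∧
        ts[i] ∉ U ∧ ∀ i' (hi' : i' < ts.length), i < i' → ts[i'] ∈ U := by
      intro i hi
      obtain ⟨U, hU0, hUadd, hVU, hti, hlater⟩ := hchain (i + 1) (by simp; omega)
      refine ⟨U, hU0, hUadd, hVU, ?_, fun i' hi' hlt => ?_⟩
      · simpa using hti
      · have := hlater (i' + 1) (by simp; omega) (by omega)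
        simpa using this
    -- the set for the head
    obtain ⟨U, hU0, hUadd, hVU, ht, hlater⟩ := hchain 0 (by simp)
    have ht' : t ∉ U := by simpa using ht
    have hmem : ∀ t' ∈ ts ++ rest, t' ∈ U := by
      intro t' ht'
      rw [List.mem_append] at ht'
      rcases ht' with h | h
      · obtain ⟨i, hi, rfl⟩ := List.getElem_of_mem h
        have := hlater (i + 1) (by simp; omega) (by omega)
        simpa using this
      · exact hVU (hrest t' h)
    rw [List.cons_append, List.foldr_cons, List.map_append, List.sum_append, ih hchain', List.map_map]
    -- the peeled half vanishes
    have hz : ((List.foldr (fun t L => L ++ L.map (fun x => bxor x t)) [q] (ts ++ rest)).map (τ ∘ fun x => bxor x t)).sum = 0 := by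
      refine List.sum_eq_zero fun z hz => ?_
      rw [List.mem_map] at hz
      obtain ⟨y, hy, rfl⟩ := hz
      refine hτ _ fun hmemA => ht' ?_
      have hqy : bxor q y ∈ U := kbm_pts_mem (ts ++ rest) U hU0 hUadd hmem q y hy
      obtain ⟨v, hv, hvy⟩ := mem_image.1 hmemA
      -- `q ⊕ v = y ⊕ t`, so `t = (q ⊕ y) ⊕ v ∈ U`
      have e : t = bxor (bxor q y) v := by
        funext j
        have h := congrFun hvy j
        simp only [bxor] at h ⊢
        revert h
        cases q j <;> cases v j <;> cases y j <;> cases t j <;> simp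
      rw [e]
      exact hUadd _ hqy _ (hVU hv)
    rw [hz, add_zero]

/-! ### Existence of transversal chains -/

/-- **Transversal chains exist** as long as there is room: for a `⊕`-closed `V ∋ 0` and `2^i · #V < 2^n` there are directions `ts` of length
`i` admitting a transversal chain over `V` (pick `t` outside the current closed set and double it, `fo_double_closed`). [this work] -/
theorem kbm_chain_exists (V : Finset (Fin n → Bool)) (hV0 : zeroVec ∈ V) (hVadd : ∀ a ∈ V, ∀ b ∈ V, bxor a b ∈ V) :
    ∀ i : ℕ, 2 ^ i * #V ≤ 2 ^ n →
      ∃ (ts : List (Fin n → Bool)) (U : Finset (Fin n → Bool)), ts.length = i ∧ zeroVec ∈ U ∧ (∀ a ∈ U, ∀ b ∈ U, bxor a b ∈ U) ∧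
        V ⊆ U ∧ (∀ t ∈ ts, t ∈ U) ∧ #U ≤ 2 ^ i * #V ∧
        (∀ j (hj : j < ts.length), ∃ W : Finset (Fin n → Bool), zeroVec ∈ W ∧ (∀ a ∈ W, ∀ b ∈ W, bxor a b ∈ W) ∧ V ⊆ W ∧
          ts[j] ∉ W ∧ ∀ j' (hj' : j' < ts.length), j < j' → ts[j'] ∈ W) := by
  classical
  intro i
  induction i with
  | zero =>
    intro _
    exact ⟨[], V, rfl, hV0, hVadd, subset_rfl, fun t ht => by simp at ht, by simp, fun j hj => by simp at hj⟩
  | succ i ih =>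
    intro hroom
    have h2 : 2 * (2 ^ i * #V) ≤ 2 ^ n := by
      calc 2 * (2 ^ i * #V) = 2 ^ (i + 1) * #V := by ring
        _ ≤ 2 ^ n := hroom
    have hX : 0 < 2 ^ i * #V := Nat.mul_pos (Nat.two_pow_pos i) (card_pos.2 ⟨zeroVec, hV0⟩)
    have hroom' : 2 ^ i * #V ≤ 2 ^ n := by omega
    obtain ⟨ts, U, hlen, hU0, hUadd, hVU, hts, hcard, hchain⟩ := ih hroom'
    -- room for one more direction
    have hUlt : #U < #(univ : Finset (Fin n → Bool)) := by
      rw [card_univ, Fintype.card_fun, Fintype.card_bool, Fintype.card_fin]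
      omega
    obtain ⟨t, -, ht⟩ := exists_mem_notMem_of_card_lt_card hUlt
    obtain ⟨hU'0, hU'add, hUU', htU', hcard'⟩ := fo_double_closed U hU0 hUadd t
    refine ⟨t :: ts, U ∪ U.image (bxor t), by simp [hlen], hU'0, hU'add, hVU.trans hUU', ?_, ?_, ?_⟩
    · intro t' ht'
      rcases List.mem_cons.1 ht' with rfl | h
      · exact htU'
      · exact hUU' (hts t' h)
    · calc #(U ∪ U.image (bxor t)) ≤ 2 * #U := hcard'
        _ ≤ 2 * (2 ^ i * #V) := Nat.mul_le_mul_left _ hcard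
        _ = 2 ^ (i + 1) * #V := by ring
    · intro j hj
      rcases Nat.eq_zero_or_pos j with rfl | hjpos
      · refine ⟨U, hU0, hUadd, hVU, by simpa using ht, fun j' hj' hlt => ?_⟩
        obtain ⟨j'', rfl⟩ : ∃ j'', j' = j'' + 1 := ⟨j' - 1, by omega⟩
        have hj''' : j'' < ts.length := by simp at hj'; omega
        have : ts[j''] ∈ U := hts _ (List.getElem_mem hj''')
        simpa using this
      · obtain ⟨j₀, rfl⟩ : ∃ j₀, j = j₀ + 1 := ⟨j - 1, by omega⟩
        obtain ⟨W, hW0, hWadd, hVW, hnot, hlater⟩ := hchain j₀ (by simp at hj; omega)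
        refine ⟨W, hW0, hWadd, hVW, by simpa using hnot, fun j' hj' hlt => ?_⟩
        obtain ⟨j'', rfl⟩ : ∃ j'', j' = j'' + 1 := ⟨j' - 1, by omega⟩
        have := hlater j'' (by simp at hj'; omega) (by omega)
        simpa using this

end Summit.QuantumAdvantage.QuantumAdvantage.Theorems.CubicForrelation.NearExactIsExact

end
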